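import Literature.Claims.NS.LiuYong2026
import Literature.Analysis.FluidPDE.TorusNSSobolevControlLifespan
import Literature.Analysis.FluidPDE.TorusClassicalLerayHopfProofs
import Literature.Analysis.FluidPDE.DuchonRobertLionsCounterexample
import HarnessLib

/-!
# Refutation (D-0090 NS-CLAIMS, C138): two consumed steps of `LiuYong2026` are false in the kernel

Claim skeleton `Literature/Claims/NS/LiuYong2026.lean` (ns-claims-typist-7 g5, p508975) of 刘勇 (Liu Yong), Zenodo
10.5281/zenodo.19681795 (2026, zh, 60 pp.). Both negated constants are `def … : Prop` tokens CONSUMED by the skeleton's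
`claim_of_steps`, negated LITERALLY (no re-typed copy, no specialisation).
* `not_Step1_cesaro : ¬ Step1_cesaro` — §4.3 p.16 L21–p.17 L1 («Φ(k) = lim T⁻¹∫₀ᵀ 𝓔(k,t)dt; this limit exists by the
  ergodicity of the weak solution»), the FIRST disputed token in the order of record. WITNESS inside the data class of
  Thm 1 (ν = 1; a smooth divergence-free force is CARRIED by the printed theorem): the log-slowly modulated shear
  `u(t,x) = a(t)·Re(e₁e^{2πix₂})`, `a(t)² = 3/2 + ½ sin log(1+t)`, zero pressure, force `(a′ + 4π²a)·Re(e₁e^{2πix₂})` — an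
  exact classical, hence global Leray–Hopf, solution on `[0,∞) × 𝕋³` whose mode-`(0,1,0)` Cesàro means are
  `κ(G(T) + 1/4)/T`, `G(T) = 3T/2 + (1+T)(sin L − cos L)/4`, `L = log(1+T)`, `κ > 0`: equal to `5κ/4` at `L ∈ 2πℕ` and
  tending to `7κ/4` along `L ∈ π/2 + 2πℕ` — NO limit, so this weak solution has no Cesàro spectrum at all.
* `not_Step3_K41 : ¬ Step3_K41` — 引理4.2 p.17 + 命题4.4 proof p.18 L22–L23 («there is C > 0 with Φ(k) ~ Ck^{−5/3} for
  all large k» for the weak solution of the chain). WITNESS at the Clay grain f ≡ 0: the REST STATE (ν = 1, f ≡ 0,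
  u₀ = 0, u ≡ 0) is a global Leray–Hopf solution with Cesàro spectrum Φ ≡ 0, and `IsK41 0` is false (`0·|k|^{5/3} → 0 ≠ C`
  along the cofinite filter of `ℤ³`).
Tree facts used: `Torus.IsClassicalNSSolutionOn.isLerayHopfOn_of_convex` / `.isGlobalLerayHopf` (classical ⇒ Leray–Hopf),
`isClassicalNSSolutionOn_const` (rest state), the single real Fourier mode API (`realTrigPoly`,
`mFourierCoeff_realTrigPoly_singleton`, `laplacian_realTrigPoly_singleton`, `Torus.convect_realTrigPoly_singleton_self_eq_zero`).
Author: ns-claims-refuter-5 g3 (refuter of record).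
WHAT THIS IS NOT: not a claim about NS regularity or blow-up; not a claim about any author beyond the typed locator.
-/

noncomputable section
set_option linter.dupNamespace false

open Set MeasureTheory Filter Topology intervalIntegral UnitAddTorus Finset
open scoped ContDiff BigOperators

namespace Summit.NavierStokesRegularity.NavierStokesRegularity.Theorems.LiuYong2026
open Literature.Claims.NS.LiuYong2026
open Literature.Analysis Literature.Analysis.FluidPDE Literature.Analysis.FunctionSpaces
open Literature.Analysis.FunctionSpaces.Torus

/-! ## 1. The rest state refutes Step 3 (`Step3_K41`) -/

/-- `Φ ≡ 0` does not obey the K41 law with a positive constant (the cofinite filter of `ℤ³` is proper). -/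
theorem not_isK41_zero : ¬ IsK41 (fun _ : Z3 => (0 : ℝ)) := by
  rintro ⟨C, hC, ht⟩
  haveI : Infinite Z3 := Pi.infinite_of_exists_right (0 : Fin 3)
  have h0 : (fun k : Z3 => (0 : ℝ) * klen k ^ (5 / 3 : ℝ)) = fun _ => (0 : ℝ) := by
    funext k; exact zero_mul _
  rw [h0, tendsto_const_nhds_iff] at ht
  exact hC.ne ht

/-- The Fourier coefficients of the zero slice vanish. -/
private theorem coeff_zero (k : Z3) : coeff (fun _ : T3 => (0 : E3)) k = 0 := by
  unfold coeff
  have h : (EuclideanSpace.complexify ∘ fun _ : T3 => (0 : E3)) = fun _ => (0 : C3) := by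
    funext x; simp
  rw [h]
  simp [UnitAddTorus.mFourierCoeff]

/-- The rest state has Cesàro spectrum `Φ ≡ 0`. -/
theorem hasCesaroSpectrum_rest :
    HasCesaroSpectrum (fun (_ : ℝ) (_ : T3) => (0 : E3)) (fun _ => 0) := by
  intro k _
  have h : (fun T : ℝ => T⁻¹ * ∫ t in (0 : ℝ)..T, modeEnergy ((fun (_ : ℝ) (_ : T3) => (0 : E3)) t) k) =
      fun _ => (0 : ℝ) := by
    funext T
    simp [modeEnergy, coeff_zero]
  rw [h]
  exact tendsto_const_nhds

/-- The rest state's data (ν = 1, f ≡ 0, u₀ = 0) belong to the data class of Thm 1. -/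
theorem isData_rest : IsData 1 (fun (_ : ℝ) (_ : T3) => (0 : E3)) (fun _ : T3 => (0 : E3)) where
  visc := one_pos
  force_smooth := isSmoothSpaceTimeOn_const (isSmooth_const (0 : E3)) _
  force_divFree t _ := (isClassicalNSSolutionOn_const (d := Fin 3) 1 0).divFree t (mem_univ t)
  datum_smooth := isSmooth_const (0 : E3)
  datum_divFree := (isClassicalNSSolutionOn_const (d := Fin 3) 1 0).divFree 0 (mem_univ 0)

/-- The rest state is a global Leray–Hopf solution (classical ⇒ Leray–Hopf). -/
theorem isGlobalLerayHopf_rest :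
    Torus.IsGlobalLerayHopf 1 (fun (_ : ℝ) (_ : T3) => (0 : E3)) (fun _ : T3 => (0 : E3))
      (fun (_ : ℝ) (_ : T3) => (0 : E3)) :=
  (isClassicalNSSolutionOn_const (d := Fin 3) 1 0).isGlobalLerayHopf

/-- **Refutation of Step 3** (引理4.2 p.17 L4–p.18 L5 + 命题4.4 proof p.18 L22–L23): the rest state is a global
weak solution from the data `(ν, f, u₀) = (1, 0, 0)` of Thm 1 with Cesàro spectrum `Φ ≡ 0`, which does not obey
`Φ(k) ~ C k^{−5/3}` with `C > 0`. [cite: LiuYong2026, 命题4.4 proof p.18 L22–L23] -/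
theorem not_Step3_K41 : ¬ Step3_K41 := fun h =>
  not_isK41_zero (h 1 _ _ isData_rest _ _ isGlobalLerayHopf_rest hasCesaroSpectrum_rest)

/-! ## 2. A log-slowly modulated shear refutes Step 1 (`Step1_cesaro`) -/

section Modulated

variable {d : Type*} [Fintype d] [DecidableEq d]

/-- **A time-modulated eigenmode is an exact FORCED classical solution**: for a smooth divergence-free `w`
with `Δw = −c w`, `(w·∇)w = ∇θ`, and an amplitude `a ∈ C^∞([0,∞))`, the triple `u = a(t)w`,
`p = −a(t)²θ`, `f = (a′ + νca)w` (`a′` the derivative within `[0,∞)`) solves the forced system on `[0,∞)`. -/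
theorem isClassicalNSSolutionOn_modulated {ν c : ℝ}
    {w : UnitAddTorus d → EuclideanSpace ℝ d} (hw : Torus.IsSmooth w) (hdiv : Torus.IsDivFree w)
    (hlap : ∀ x, Torus.laplacian w x = -(c • w x))
    {θ : UnitAddTorus d → ℝ} (hθ : Torus.IsSmooth θ)
    (hconv : ∀ x, Torus.convect w w x = Torus.gradient θ x)
    {a : ℝ → ℝ} (ha : ContDiffOn ℝ ∞ a (Ici 0)) :
    Torus.IsClassicalNSSolutionOn (Ici 0) ν
      (fun t x => (derivWithin a (Ici 0) t + ν * c * a t) • w x)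
      (fun t x => a t • w x) (fun t x => (-(a t ^ 2)) * θ x) where
  smooth_velocity :=
    (isSmoothSpaceTimeOn_of_time (θ := a) ha).smul (isSmoothSpaceTimeOn_const hw _)
  smooth_pressure :=
    (isSmoothSpaceTimeOn_of_time (θ := fun t : ℝ => -(a t ^ 2)) ((ha.pow 2).neg)).mul
      (isSmoothSpaceTimeOn_const hθ _)
  momentum t ht x := by
    set e : ℝ := a t with he
    have hw1 : Torus.IsContDiff 1 w := hw.isContDiff (by simp)
    have hθ1 : Torus.IsContDiff 1 θ := hθ.isContDiff (by simp)
    have h1 : Torus.timeDerivWithin (Ici 0) (fun t x => a t • w x) t x = (derivWithin a (Ici 0) t) • w x := by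
      have hd : HasDerivWithinAt (fun τ : ℝ => a τ • w x) ((derivWithin a (Ici 0) t) • w x) (Ici 0) t :=
        ((ha.differentiableOn (by simp)) t ht).hasDerivWithinAt.smul_const (w x)
      exact hd.derivWithin (uniqueDiffOn_Ici 0 t ht)
    have h2 : Torus.convect (fun x => e • w x) (fun x => e • w x) x = e • (e • Torus.gradient θ x) := by
      show Torus.fderiv (e • w) x ((e • w) x) = _
      rw [fderiv_const_smul hw1 e x, FunLike.coe_smul, Pi.smul_apply, Pi.smul_apply,
        map_smul, ← hconv x]
      rfl
    have h3 : Torus.laplacian (fun x => e • w x) x = e • (-(c • w x)) := by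
      show Torus.laplacian (e • w) x = _
      rw [laplacian_const_smul_apply hw e x, hlap x]
    have h4 : Torus.gradient (fun x => (-(e ^ 2)) * θ x) x = (-(e ^ 2)) • Torus.gradient θ x := by
      show Torus.gradient ((-(e ^ 2)) • θ) x = _
      exact Torus.gradient_const_smul hθ1 _ x
    rw [h1]
    show (derivWithin a (Ici 0) t) • w x + Torus.convect (fun x => e • w x) (fun x => e • w x) x =
      ν • Torus.laplacian (fun x => e • w x) x - Torus.gradient (fun x => (-(e ^ 2)) * θ x) x +
        (derivWithin a (Ici 0) t + ν * c * e) • w x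
    rw [h2, h3, h4]
    module
  divFree t _ x := by
    show Torus.divergence (a t • w) x = 0
    exact Torus.isDivFree_const_smul (hw.isContDiff (by simp)) hdiv _ x

omit [DecidableEq d] in
/-- `∇0 = 0` on the torus. -/
private theorem gradient_zero' (x : UnitAddTorus d) :
    Torus.gradient (fun _ : UnitAddTorus d => (0 : ℝ)) x = 0 := by
  unfold Torus.gradient liftAt
  simp [_root_.gradient]

/-- **Modulated single real Fourier mode** `u = a(t)·Re(e_k z)`, `k·z = 0`: an exact classical solution on `[0,∞)`
with zero pressure and force `(a′ + 4π²ν|k|²a)·Re(e_k z)`. -/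
theorem isClassicalNSSolutionOn_modulated_singleton (ν : ℝ) {k₀ : d → ℤ}
    {c : (d → ℤ) → EuclideanSpace ℂ d} (hz : ∑ j, (k₀ j : ℂ) * c k₀ j = 0) {a : ℝ → ℝ}
    (ha : ContDiffOn ℝ ∞ a (Ici 0)) :
    Torus.IsClassicalNSSolutionOn (Ici 0) ν
      (fun t x => (derivWithin a (Ici 0) t + ν * (4 * Real.pi ^ 2 * freqNormSq k₀) * a t) •
        realTrigPoly {k₀} c x)
      (fun t x => a t • realTrigPoly {k₀} c x) (fun _ _ => 0) := by
  have h := isClassicalNSSolutionOn_modulated (ν := ν)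
    (c := 4 * Real.pi ^ 2 * freqNormSq k₀) (isSmooth_realTrigPoly {k₀} c)
    (isDivFree_realTrigPoly_singleton hz)
    (fun x => by rw [laplacian_realTrigPoly_singleton, neg_smul]) (isSmooth_const (0 : ℝ))
    (fun x => by rw [Torus.convect_realTrigPoly_singleton_self_eq_zero hz, gradient_zero']) ha
  have hp : (fun (t : ℝ) (_ : UnitAddTorus d) => (-(a t ^ 2)) * (0 : ℝ)) = fun _ _ => (0 : ℝ) := by
    funext t x; ring
  rw [hp] at h
  exact h

end Modulated

/-! ### The witness: mode `k₀ = (0,1,0)`, polarisation `e₁`, amplitude `a(t)² = 3/2 + ½ sin log(1+t)` -/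
/-- The wave vector `k₀ = (0,1,0)`. -/
def kay : Z3 := Pi.single 1 1

/-- The polarisation `z = e₁ ∈ ℂ³` (`k₀ · z = 0`). -/
def pol : Z3 → C3 := fun _ => EuclideanSpace.single 0 1
/-- The witness frequency `k₀ = (0,1,0)` is nonzero. -/
theorem kay_ne_zero : kay ≠ 0 := fun h => by simpa [kay] using congrFun h 1
/-- `k₀ ≠ -k₀`. -/
private theorem kay_ne_neg : kay ≠ -kay := fun h => by simpa [kay] using congrFun h 1
/-- `k₀ · c = 0`: the polarisation `e₀` is orthogonal to `k₀ = e₁` (divergence-free mode). -/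
private theorem kay_orth : ∑ j, (kay j : ℂ) * pol kay j = 0 := by
  simp [kay, pol, Pi.single_apply]

/-- The squared amplitude `g(t) = 3/2 + ½ sin log(1+t)` (≥ 1 everywhere). -/
def gsq (t : ℝ) : ℝ := 3 / 2 + Real.sin (Real.log (1 + t)) / 2

/-- The amplitude `a = √g`. -/
def amp (t : ℝ) : ℝ := Real.sqrt (gsq t)
/-- `g(t)² = 3/2 + ½ sin log(1+t) ≥ 1`. -/
private theorem one_le_gsq (t : ℝ) : 1 ≤ gsq t := by
  unfold gsq
  have := Real.neg_one_le_sin (Real.log (1 + t))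
  linarith
/-- `a(t)² = g(t)²`. -/
private theorem amp_sq (t : ℝ) : amp t ^ 2 = gsq t :=
  Real.sq_sqrt (by linarith [one_le_gsq t])
/-- `t ↦ 3/2 + ½ sin log(1+t)` is smooth on `[0,∞)`. -/
private theorem contDiffOn_gsq : ContDiffOn ℝ ∞ gsq (Ici 0) := by
  have hlog : ContDiffOn ℝ ∞ (fun t : ℝ => Real.log (1 + t)) (Ici 0) :=
    (contDiffOn_const.add contDiffOn_id).log fun t ht => by
      simp only [Set.mem_Ici] at ht
      show (1 : ℝ) + t ≠ 0
      linarith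
  exact contDiffOn_const.add ((Real.contDiff_sin.comp_contDiffOn hlog).div_const _)
/-- The amplitude `a = √(3/2 + ½ sin log(1+t))` is smooth on `[0,∞)` (radicand `≥ 1`). -/
private theorem contDiffOn_amp : ContDiffOn ℝ ∞ amp (Ici 0) :=
  contDiffOn_gsq.sqrt fun t _ => by linarith [one_le_gsq t]

/-- The witness velocity `u(t,x) = a(t)·Re(e₁ e^{2πi x₂})`. -/
def vel (t : ℝ) (x : T3) : E3 := amp t • realTrigPoly {kay} pol x

/-- Its force `(a′ + 4π²a)·Re(e₁ e^{2πi x₂})` (ν = 1, `|k₀|² = 1`). -/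
def frc (t : ℝ) (x : T3) : E3 :=
  (derivWithin amp (Ici 0) t + 1 * (4 * Real.pi ^ 2 * freqNormSq kay) * amp t) • realTrigPoly {kay} pol x
/-- The modulated mode is an exact classical forced solution on `[0,∞)` (pressure `0`). -/
theorem isClassical_vel : Torus.IsClassicalNSSolutionOn (Ici 0) 1 frc vel (fun _ _ => 0) :=
  isClassicalNSSolutionOn_modulated_singleton 1 kay_orth contDiffOn_amp

/-- The witness is a global Leray–Hopf solution from its own initial slice. -/
theorem isGlobalLerayHopf_vel : Torus.IsGlobalLerayHopf 1 frc (vel 0) vel :=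
  fun _ hT => isClassical_vel.isLerayHopfOn_of_convex (convex_Ici 0) hT Icc_subset_Ici_self

/-- The witness data belong to the data class of Thm 1 (smooth divergence-free force and datum). -/
theorem isData_vel : IsData 1 frc (vel 0) where
  visc := one_pos
  force_smooth := by
    have hθ : ContDiffOn ℝ ∞
        (fun t : ℝ => derivWithin amp (Ici 0) t + 1 * (4 * Real.pi ^ 2 * freqNormSq kay) * amp t) (Ici 0) :=
      ((contDiffOn_infty_iff_derivWithin (uniqueDiffOn_Ici 0)).1 contDiffOn_amp).2.add
        (contDiffOn_const.mul contDiffOn_amp)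
    exact (isSmoothSpaceTimeOn_of_time hθ).smul (isSmoothSpaceTimeOn_const (isSmooth_realTrigPoly {kay} pol) _)
  force_divFree t _ :=
    Torus.isDivFree_const_smul ((isSmooth_realTrigPoly {kay} pol).isContDiff (by simp))
      (isDivFree_realTrigPoly_singleton kay_orth) _
  datum_smooth := (isSmooth_realTrigPoly {kay} pol).const_smul (amp 0)
  datum_divFree :=
    Torus.isDivFree_const_smul ((isSmooth_realTrigPoly {kay} pol).isContDiff (by simp))
      (isDivFree_realTrigPoly_singleton kay_orth) _

/-! ### The mode-`k₀` energy and its Cesàro means -/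

/-- `κ = ½‖Re-mode coefficient‖²`, the energy of the unmodulated mode. -/
def kap : ℝ := (1 / 2 : ℝ) * ‖coeff (realTrigPoly {kay} pol) kay‖ ^ 2
/-- The `k₀`-Fourier coefficient of the real mode is `c/2`. -/
private theorem coeff_mode : coeff (realTrigPoly {kay} pol) kay = (2 : ℂ)⁻¹ • pol kay := by
  unfold coeff
  rw [mFourierCoeff_realTrigPoly_singleton, if_pos rfl, if_neg kay_ne_neg, EuclideanSpace.conjVec_zero, add_zero]
/-- `κ = ½‖c/2‖² > 0`. -/
private theorem kap_pos : 0 < kap := by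
  unfold kap
  rw [coeff_mode]
  have hz : pol kay ≠ 0 := by
    intro h
    have := congrArg (fun v : C3 => v 0) h
    simp [pol] at this
  have : (2 : ℂ)⁻¹ • pol kay ≠ 0 := smul_ne_zero (by norm_num) hz
  positivity

/-- `𝓔(k₀, t) = κ · g(t)` along the witness. -/
theorem modeEnergy_vel (t : ℝ) : modeEnergy (vel t) kay = kap * gsq t := by
  unfold modeEnergy kap
  have h : coeff (vel t) kay = ((amp t : ℝ) : ℂ) • coeff (realTrigPoly {kay} pol) kay := by
    unfold coeff vel
    have hfun : (EuclideanSpace.complexify ∘ fun x : T3 => amp t • realTrigPoly {kay} pol x) =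
        ((amp t : ℝ) : ℂ) • (EuclideanSpace.complexify ∘ realTrigPoly {kay} pol) := by
      funext x
      simp only [Function.comp_apply, Pi.smul_apply, map_smul, Complex.coe_smul]
    rw [hfun, mFourierCoeff_const_smul]
  rw [h, norm_smul, Complex.norm_real, Real.norm_eq_abs, mul_pow, sq_abs, amp_sq]
  ring

/-- A primitive of `g` on `[0,∞)`: `G(t) = 3t/2 + (1+t)(sin L − cos L)/4`, `L = log(1+t)`. -/
def Gee (t : ℝ) : ℝ :=
  3 / 2 * t + (1 + t) * (Real.sin (Real.log (1 + t)) - Real.cos (Real.log (1 + t))) / 4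
/-- `G' = g²` on `(-1,∞)`: an explicit primitive of the modal energy profile. -/
private theorem hasDerivAt_Gee {t : ℝ} (ht : -1 < t) : HasDerivAt Gee (gsq t) t := by
  have h1 : (1 : ℝ) + t ≠ 0 := by linarith
  have hL : HasDerivAt (fun s : ℝ => Real.log (1 + s)) (1 / (1 + t)) t := by
    simpa using ((hasDerivAt_id t).const_add 1).log h1
  have hG := ((hasDerivAt_id t).const_mul (3 / 2 : ℝ)).add
    ((((hasDerivAt_id t).const_add 1).mul (hL.sin.sub hL.cos)).div_const 4)
  refine (hG.congr_of_eventuallyEq (Eventually.of_forall fun s => ?_)).congr_deriv ?_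
  · simp only [Gee, Pi.add_apply, Pi.mul_apply, Pi.sub_apply, id]
  · simp only [gsq, Pi.sub_apply, id]; field_simp; ring

/-- `∫₀ᵀ 𝓔(k₀,t) dt = κ (G(T) − G(0))` for `T ≥ 0`. -/
theorem integral_modeEnergy_vel {T : ℝ} (hT : 0 ≤ T) :
    ∫ t in (0 : ℝ)..T, modeEnergy (vel t) kay = kap * (Gee T - Gee 0) := by
  simp_rw [modeEnergy_vel]
  rw [intervalIntegral.integral_const_mul]
  congr 1
  have hderiv : ∀ t ∈ uIcc 0 T, HasDerivAt Gee (gsq t) t := fun t ht => by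
    rw [uIcc_of_le hT] at ht
    exact hasDerivAt_Gee (by linarith [ht.1])
  have hcont : ContinuousOn gsq (uIcc 0 T) :=
    contDiffOn_gsq.continuousOn.mono (by rw [uIcc_of_le hT]; exact fun s hs => hs.1)
  exact integral_eq_sub_of_hasDerivAt hderiv hcont.intervalIntegrable
/-- `G(0) = -1/4`. -/
private theorem Gee_zero : Gee 0 = -1 / 4 := by
  norm_num [Gee]

/-- First subsequence `T_n = e^{2πn} − 1`: the Cesàro mean is exactly `5κ/4`. -/
private theorem cesaro_seq_one (n : ℕ) (hn : 1 ≤ n) :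
    (Real.exp (n * (2 * Real.pi)) - 1)⁻¹ * ∫ t in (0 : ℝ)..(Real.exp (n * (2 * Real.pi)) - 1),
      modeEnergy (vel t) kay = 5 / 4 * kap := by
  set T : ℝ := Real.exp (n * (2 * Real.pi)) - 1 with hT
  have hTpos : 0 < T := by
    have : (1 : ℝ) < Real.exp (n * (2 * Real.pi)) := by
      have hn' : (0 : ℝ) < n * (2 * Real.pi) := by
        have : (1 : ℝ) ≤ n := by exact_mod_cast hn
        positivity
      simpa using Real.one_lt_exp_iff.2 hn' |> fun h => by simpa using h
    linarith
  rw [integral_modeEnergy_vel hTpos.le, Gee_zero]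
  have hL : Real.log (1 + T) = n * (2 * Real.pi) := by
    rw [hT, add_sub_cancel, Real.log_exp]
  have hG : Gee T = 3 / 2 * T + (1 + T) * (0 - 1) / 4 := by
    unfold Gee
    rw [hL, Real.cos_nat_mul_two_pi]
    have : Real.sin (n * (2 * Real.pi)) = 0 := by
      simpa using Real.sin_add_nat_mul_two_pi 0 n
    rw [this]
  rw [hG]
  field_simp
  ring

/-- Second subsequence `T'_n = e^{π/2 + 2πn} − 1`: the Cesàro mean is `7κ/4 + κ/(2T'_n)`. -/
private theorem cesaro_seq_two (n : ℕ) :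
    (Real.exp (Real.pi / 2 + n * (2 * Real.pi)) - 1)⁻¹ *
        ∫ t in (0 : ℝ)..(Real.exp (Real.pi / 2 + n * (2 * Real.pi)) - 1), modeEnergy (vel t) kay =
      7 / 4 * kap + kap / 2 * (Real.exp (Real.pi / 2 + n * (2 * Real.pi)) - 1)⁻¹ := by
  set T : ℝ := Real.exp (Real.pi / 2 + n * (2 * Real.pi)) - 1 with hT
  have hTpos : 0 < T := by
    have : (1 : ℝ) < Real.exp (Real.pi / 2 + n * (2 * Real.pi)) := by
      have hn' : (0 : ℝ) < Real.pi / 2 + n * (2 * Real.pi) := by positivity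
      exact Real.one_lt_exp_iff.2 hn'
    linarith
  rw [integral_modeEnergy_vel hTpos.le, Gee_zero]
  have hL : Real.log (1 + T) = Real.pi / 2 + n * (2 * Real.pi) := by
    rw [hT, add_sub_cancel, Real.log_exp]
  have hG : Gee T = 3 / 2 * T + (1 + T) * (1 - 0) / 4 := by
    unfold Gee
    rw [hL, Real.sin_add_nat_mul_two_pi, Real.cos_add_nat_mul_two_pi, Real.sin_pi_div_two,
      Real.cos_pi_div_two]
  rw [hG]
  field_simp
  ring

/-- **The witness has NO Cesàro spectrum**: the mode-`k₀` Cesàro means have the two subsequential limits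
`5κ/4 ≠ 7κ/4`. -/
theorem not_hasCesaroSpectrum_vel (Φ : Z3 → ℝ) : ¬ HasCesaroSpectrum vel Φ := by
  intro h
  have hk := h kay kay_ne_zero
  set F : ℝ → ℝ := fun T => T⁻¹ * ∫ t in (0 : ℝ)..T, modeEnergy (vel t) kay with hF
  -- the two time sequences tend to `+∞`
  have hexp1 : Tendsto (fun n : ℕ => Real.exp (n * (2 * Real.pi)) - 1) atTop atTop := by
    refine tendsto_atTop_add_const_right _ (-1) ?_
    exact Real.tendsto_exp_atTop.comp
      (tendsto_natCast_atTop_atTop.atTop_mul_const (by positivity))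
  have hexp2 : Tendsto (fun n : ℕ => Real.exp (Real.pi / 2 + n * (2 * Real.pi)) - 1) atTop atTop := by
    refine tendsto_atTop_add_const_right _ (-1) ?_
    exact Real.tendsto_exp_atTop.comp
      (tendsto_atTop_add_const_left _ _ (tendsto_natCast_atTop_atTop.atTop_mul_const (by positivity)))
  -- limit along the first sequence: `Φ k₀ = 5κ/4`
  have h1 : Tendsto (fun n : ℕ => F (Real.exp (n * (2 * Real.pi)) - 1)) atTop (𝓝 (Φ kay)) :=
    hk.comp hexp1
  have h1' : Tendsto (fun n : ℕ => F (Real.exp (n * (2 * Real.pi)) - 1)) atTop (𝓝 (5 / 4 * kap)) := by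
    refine tendsto_const_nhds.congr' ?_
    filter_upwards [eventually_ge_atTop 1] with n hn
    exact (cesaro_seq_one n hn).symm
  have e1 : Φ kay = 5 / 4 * kap := tendsto_nhds_unique h1 h1'
  -- limit along the second sequence: `Φ k₀ = 7κ/4`
  have h2 : Tendsto (fun n : ℕ => F (Real.exp (Real.pi / 2 + n * (2 * Real.pi)) - 1)) atTop (𝓝 (Φ kay)) :=
    hk.comp hexp2
  have h2' : Tendsto (fun n : ℕ => F (Real.exp (Real.pi / 2 + n * (2 * Real.pi)) - 1)) atTop
      (𝓝 (7 / 4 * kap + kap / 2 * 0)) := by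
    have hlim : Tendsto (fun n : ℕ => 7 / 4 * kap + kap / 2 * (Real.exp (Real.pi / 2 + n * (2 * Real.pi)) - 1)⁻¹)
        atTop (𝓝 (7 / 4 * kap + kap / 2 * 0)) :=
      tendsto_const_nhds.add (tendsto_const_nhds.mul (tendsto_inv_atTop_zero.comp hexp2))
    refine hlim.congr' (Eventually.of_forall fun n => ?_)
    exact (cesaro_seq_two n).symm
  have e2 : Φ kay = 7 / 4 * kap + kap / 2 * 0 := tendsto_nhds_unique h2 h2'
  have := kap_pos
  linarith

/-- **Refutation of Step 1** (§4.3 p.16 L21–p.17 L1, «the limit exists by ergodicity»): the log-slowly modulated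
shear is a global Leray–Hopf (indeed classical) solution of the forced system from data in the class of Thm 1
that has no Cesàro energy spectrum. [cite: LiuYong2026, §4.3 p.16 L21–p.17 L1] -/
theorem not_Step1_cesaro : ¬ Step1_cesaro := by
  intro h
  obtain ⟨Φ, hΦ⟩ := h 1 frc (vel 0) isData_vel vel isGlobalLerayHopf_vel
  exact not_hasCesaroSpectrum_vel Φ hΦ
example : ¬ Literature.Claims.NS.LiuYong2026.Step1_cesaro := not_Step1_cesaro
example : ¬ Literature.Claims.NS.LiuYong2026.Step3_K41 := not_Step3_K41
end Summit.NavierStokesRegularity.NavierStokesRegularity.Theorems.LiuYong2026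
end
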